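import Summits.HodgeConjecture.HodgeConjecture.Theorems.BoundaryReadoutBoundarySupplyAnchors
import Literature.AlgebraicGeometry.HodgeTheory.AlgebraicClasses
import Literature.AlgebraicGeometry.HodgeTheory.ComplexConjugationHolds
import Literature.AlgebraicGeometry.Motives.ComplexPointsManifold
import HarnessLib

/-!
# Route BoundaryReadout — crux `BoundarySupply` (stmt-HodgeConjecture-15912): the floor of the stub `AnchorSupply`

The registered hardest stub `AnchorSupply` of line `qbar-fibre` of the crux `BoundarySupply` asks, for
every rational `(p,p)`-class `c` on a smooth projective `X/ℂ`, for a family over a curve whose fibre `X_o`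
is covered by pieces `Y_i` that are ARITHMETIC or on which the global class restricts to a CYCLE class
(`∈ algebraicClasses`). Its degenerate part is free, exactly as for the crux
(`boundarySupply_iff_pos_ne_zero` of `BoundaryReadoutBoundarySupplyDegreeZero`):

* `anchorSupply_degree_zero` — in degree `0` every class is a cycle class (`algebraicClasses X 0 = ⊤`,
  `algebraicClasses_zero`), so the constant family of `X` itself is an anchor
  (`anchorSupply_block_of_mem_algebraicClasses`);
* `anchorSupply_of_eq_zero`, `anchorSupply_of_lt` — `c = 0` is a cycle class; above the dimension
  `H²ᵖ(X(ℂ)) = 0`;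
* `anchorSupply_iff_pos_ne_zero` — hence **`AnchorSupply` is equivalent to its restriction to NONZERO
  classes in the Hodge range `1 ≤ p ≤ dim X`**: its content (arithmetic / cycle anchors for genuine Hodge
  classes of positive degree — Saito–Schnell / KOU Conj. 1.5 territory) is pinned exactly, and has no
  cheap degenerate counterexample.

References: [CharlesSchnell2014Notes] §11.2.5; [KerrPearlstein2016] (Saito–Schnell, Thm 1);
[HatcherAT2002] Thm. 3.26; [GrothendieckTopology1969] §1.
-/

-- every declaration of this problem lives in `Summit.HodgeConjecture.HodgeConjecture.…` (summit = sub-problem)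
set_option linter.dupNamespace false

noncomputable section

namespace Summit.HodgeConjecture.HodgeConjecture.Theorems

open CategoryTheory CategoryTheory.Limits AlgebraicGeometry
open Literature.AlgebraicTopology.SingularHomology
open Literature.AlgebraicGeometry.Motives Literature.AlgebraicGeometry.HodgeTheory
open Summit.HodgeConjecture.HodgeConjecture.Theses

section AnchorsFloor

variable {n : ℕ} {X : SchemeOver ℂ}

/-- **The `∃`-block of `AnchorSupply` in degree `0`**: every class of `H⁰(X(ℂ); ℂ)` is a cycle class
(`algebraicClasses X 0 = ⊤`), so the constant family of `X` with its one piece `Y = X` and the CYCLE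
disjunct is an anchor. [cite: GrothendieckTopology1969, §1] [cite: CharlesSchnell2014Notes, §11.2.5] -/
theorem anchorSupply_degree_zero (hX : IsSmoothProjective n X) (c : complexBetti X (2 * 0))
    (hc : IsRationalClass c) (hpp : IsOfHodgeType n X (2 * 0) 0 0 c) :
    ∃ (N : ℕ) (𝒳 C : SchemeOver ℂ) (f : 𝒳 ⟶ C) (o t : AlgPoints C ℂ) (ι : Type) (_ : Finite ι)
      (m : ι → ℕ) (Y : ι → SchemeOver ℂ) (g : ∀ i, Y i ⟶ fiberOver f o)
      (ξ : complexBetti 𝒳 (2 * 0)) (n' : ℕ) (e : X ⟶ fiberOver f t),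
      IsSmoothProjective N 𝒳 ∧ IsSmoothProjective 1 C ∧ Function.Surjective f.left.base ∧
      (∀ i, IsSmoothProjective (m i) (Y i)) ∧
      (∀ x : ↥(fiberOver f o).left, ∃ (i : ι) (y : ↥(Y i).left), (g i).left.base y = x) ∧
      IsRationalClass ξ ∧ IsOfHodgeType N 𝒳 (2 * 0) 0 0 ξ ∧
      (∀ i, (∃ (K : Type) (_ : Field K) (_ : NumberField K) (σ : K →+* ℂ) (Y₀ : SchemeOver K),
          Nonempty (Y i ≅ (baseChangeHom σ).obj Y₀)) ∨
        complexBetti.map (g i ≫ fiberι f o) (2 * 0) ξ ∈ algebraicClasses (Y i) 0) ∧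
      IsSmoothProjective n' (fiberOver f t) ∧
      complexBetti.map e (2 * 0) (complexBetti.map (fiberι f t) (2 * 0) ξ) = c :=
  anchorSupply_block_of_mem_algebraicClasses hX 0 c hc hpp (by rw [algebraicClasses_zero]; trivial)

/-- **The `∃`-block of `AnchorSupply` for the zero class** (any degree): `0` is a rational `(p,p)` cycle
class, anchored by the constant family. [cite: CharlesSchnell2014Notes, §11.2.5] -/
theorem anchorSupply_of_eq_zero (hX : IsSmoothProjective n X) (p : ℕ) {c : complexBetti X (2 * p)}
    (hc0 : c = 0) :
    ∃ (N : ℕ) (𝒳 C : SchemeOver ℂ) (f : 𝒳 ⟶ C) (o t : AlgPoints C ℂ) (ι : Type) (_ : Finite ι)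
      (m : ι → ℕ) (Y : ι → SchemeOver ℂ) (g : ∀ i, Y i ⟶ fiberOver f o)
      (ξ : complexBetti 𝒳 (2 * p)) (n' : ℕ) (e : X ⟶ fiberOver f t),
      IsSmoothProjective N 𝒳 ∧ IsSmoothProjective 1 C ∧ Function.Surjective f.left.base ∧
      (∀ i, IsSmoothProjective (m i) (Y i)) ∧
      (∀ x : ↥(fiberOver f o).left, ∃ (i : ι) (y : ↥(Y i).left), (g i).left.base y = x) ∧
      IsRationalClass ξ ∧ IsOfHodgeType N 𝒳 (2 * p) p p ξ ∧
      (∀ i, (∃ (K : Type) (_ : Field K) (_ : NumberField K) (σ : K →+* ℂ) (Y₀ : SchemeOver K),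
          Nonempty (Y i ≅ (baseChangeHom σ).obj Y₀)) ∨
        complexBetti.map (g i ≫ fiberι f o) (2 * p) ξ ∈ algebraicClasses (Y i) p) ∧
      IsSmoothProjective n' (fiberOver f t) ∧
      complexBetti.map e (2 * p) (complexBetti.map (fiberι f t) (2 * p) ξ) = c := by
  subst hc0
  exact anchorSupply_block_of_mem_algebraicClasses hX p 0 IsRationalClass.zero
    (isOfHodgeType_zero_of_isSmoothProjective nonempty_hodgeModel_holds hX _ _ _) (Submodule.zero_mem _)

/-- **Above the dimension `AnchorSupply` is free**: for `p > dim X`, `H²ᵖ(X(ℂ); ℂ) = 0` (Hatcher 3.26), so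
every class is `0`. [cite: HatcherAT2002, Thm. 3.26] -/
theorem anchorSupply_of_lt (hX : IsSmoothProjective n X) {p : ℕ} (hnp : n < p) (c : complexBetti X (2 * p)) :
    ∃ (N : ℕ) (𝒳 C : SchemeOver ℂ) (f : 𝒳 ⟶ C) (o t : AlgPoints C ℂ) (ι : Type) (_ : Finite ι)
      (m : ι → ℕ) (Y : ι → SchemeOver ℂ) (g : ∀ i, Y i ⟶ fiberOver f o)
      (ξ : complexBetti 𝒳 (2 * p)) (n' : ℕ) (e : X ⟶ fiberOver f t),
      IsSmoothProjective N 𝒳 ∧ IsSmoothProjective 1 C ∧ Function.Surjective f.left.base ∧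
      (∀ i, IsSmoothProjective (m i) (Y i)) ∧
      (∀ x : ↥(fiberOver f o).left, ∃ (i : ι) (y : ↥(Y i).left), (g i).left.base y = x) ∧
      IsRationalClass ξ ∧ IsOfHodgeType N 𝒳 (2 * p) p p ξ ∧
      (∀ i, (∃ (K : Type) (_ : Field K) (_ : NumberField K) (σ : K →+* ℂ) (Y₀ : SchemeOver K),
          Nonempty (Y i ≅ (baseChangeHom σ).obj Y₀)) ∨
        complexBetti.map (g i ≫ fiberι f o) (2 * p) ξ ∈ algebraicClasses (Y i) p) ∧
      IsSmoothProjective n' (fiberOver f t) ∧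
      complexBetti.map e (2 * p) (complexBetti.map (fiberι f t) (2 * p) ξ) = c := by
  haveI := ComplexPoints.subsingleton_singularCohomology_of_lt hX ℂ (k := 2 * p) (by omega)
  exact anchorSupply_of_eq_zero hX p (Subsingleton.elim _ _)

/-- **The content of `AnchorSupply`, exactly.** The registered hardest stub `AnchorSupply` of line
`qbar-fibre` (statement verbatim on the left) is EQUIVALENT to its restriction to NONZERO classes in the
Hodge range `1 ≤ p ≤ dim X`: degree `0` and `c = 0` are cycle classes on the constant family
(`anchorSupply_degree_zero`, `anchorSupply_of_eq_zero`), and `p > dim X` is empty (`anchorSupply_of_lt`).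
So, like the crux itself (`boundarySupply_iff_pos_ne_zero`), the stub has no degenerate counterexample;
its content is the arithmetic / cycle anchoring of genuine positive-degree Hodge classes.
[cite: CharlesSchnell2014Notes, §11.2.5] [cite: KerrPearlstein2016, Saito–Schnell Thm 1 and Cor. 1] -/
theorem anchorSupply_iff_pos_ne_zero :
    (∀ ⦃n : ℕ⦄ ⦃X : SchemeOver ℂ⦄, IsSmoothProjective n X →
      ∀ (p : ℕ) (c : complexBetti X (2 * p)), IsRationalClass c → IsOfHodgeType n X (2 * p) p p c →
      ∃ (N : ℕ) (𝒳 C : SchemeOver ℂ) (f : 𝒳 ⟶ C) (o t : AlgPoints C ℂ) (ι : Type) (_ : Finite ι)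
        (m : ι → ℕ) (Y : ι → SchemeOver ℂ) (g : ∀ i, Y i ⟶ fiberOver f o)
        (ξ : complexBetti 𝒳 (2 * p)) (n' : ℕ) (e : X ⟶ fiberOver f t),
        IsSmoothProjective N 𝒳 ∧ IsSmoothProjective 1 C ∧ Function.Surjective f.left.base ∧
        (∀ i, IsSmoothProjective (m i) (Y i)) ∧
        (∀ x : ↥(fiberOver f o).left, ∃ (i : ι) (y : ↥(Y i).left), (g i).left.base y = x) ∧
        IsRationalClass ξ ∧ IsOfHodgeType N 𝒳 (2 * p) p p ξ ∧
        (∀ i, (∃ (K : Type) (_ : Field K) (_ : NumberField K) (σ : K →+* ℂ) (Y₀ : SchemeOver K),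
            Nonempty (Y i ≅ (baseChangeHom σ).obj Y₀)) ∨
          complexBetti.map (g i ≫ fiberι f o) (2 * p) ξ ∈ algebraicClasses (Y i) p) ∧
        IsSmoothProjective n' (fiberOver f t) ∧
        complexBetti.map e (2 * p) (complexBetti.map (fiberι f t) (2 * p) ξ) = c) ↔
    (∀ ⦃n : ℕ⦄ ⦃X : SchemeOver ℂ⦄, IsSmoothProjective n X →
      ∀ (p : ℕ) (c : complexBetti X (2 * p)), IsRationalClass c → IsOfHodgeType n X (2 * p) p p c →
      1 ≤ p → p ≤ n → c ≠ 0 →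
      ∃ (N : ℕ) (𝒳 C : SchemeOver ℂ) (f : 𝒳 ⟶ C) (o t : AlgPoints C ℂ) (ι : Type) (_ : Finite ι)
        (m : ι → ℕ) (Y : ι → SchemeOver ℂ) (g : ∀ i, Y i ⟶ fiberOver f o)
        (ξ : complexBetti 𝒳 (2 * p)) (n' : ℕ) (e : X ⟶ fiberOver f t),
        IsSmoothProjective N 𝒳 ∧ IsSmoothProjective 1 C ∧ Function.Surjective f.left.base ∧
        (∀ i, IsSmoothProjective (m i) (Y i)) ∧
        (∀ x : ↥(fiberOver f o).left, ∃ (i : ι) (y : ↥(Y i).left), (g i).left.base y = x) ∧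
        IsRationalClass ξ ∧ IsOfHodgeType N 𝒳 (2 * p) p p ξ ∧
        (∀ i, (∃ (K : Type) (_ : Field K) (_ : NumberField K) (σ : K →+* ℂ) (Y₀ : SchemeOver K),
            Nonempty (Y i ≅ (baseChangeHom σ).obj Y₀)) ∨
          complexBetti.map (g i ≫ fiberι f o) (2 * p) ξ ∈ algebraicClasses (Y i) p) ∧
        IsSmoothProjective n' (fiberOver f t) ∧
        complexBetti.map e (2 * p) (complexBetti.map (fiberι f t) (2 * p) ξ) = c) := by
  refine ⟨fun h n X hX p c hc hpp _ _ _ ↦ h hX p c hc hpp, fun h n X hX p c hc hpp ↦ ?_⟩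
  rcases Nat.eq_zero_or_pos p with hp | hp
  · subst hp
    exact anchorSupply_degree_zero hX c hc hpp
  by_cases hc0 : c = 0
  · exact anchorSupply_of_eq_zero hX p hc0
  have hpn : p ≤ n := by
    by_contra hlt
    haveI := ComplexPoints.subsingleton_singularCohomology_of_lt hX ℂ (k := 2 * p) (by omega)
    exact hc0 (Subsingleton.elim _ _)
  exact h hX p c hc hpp hp hpn hc0

end AnchorsFloor

end Summit.HodgeConjecture.HodgeConjecture.Theorems

end
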